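import Summits.KontsevichZagierPeriods.KontsevichZagierPeriods.Theses.HurwitzMicroSectors
import Summits.KontsevichZagierPeriods.KontsevichZagierPeriods.Theorems.HurwitzMicroSectorsNormalFormPrinciplePiBoxTransfer
import Summits.KontsevichZagierPeriods.KontsevichZagierPeriods.Theorems.HurwitzMicroSectorsNormalFormPrincipleVariants2319

/-! TTRL-lite variant V2325 of stmt-KontsevichZagierPeriods-3869

Variant V2325 = `stub_boxRigidity` (the leaf `BoxRigidity` of `NormalFormPrinciple`: two representations
on open unit boxes with integrands of KZ's rational shape `p/q` over `ℚ` and equal values are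
KZ-equivalent) under the TWO-sided move `fix_nat:m=8; fix_nat:m'=4` (left dimension frozen to `8`, right
dimension to `4`). Verdict of the attempt seat: **open** — this file is the exact-strength certificate,
not a proof of the variant. For every `K` let `BoxVanishing K` say that a box-rational representation of
dimension `K` and value `0` is a relation. The frozen pair `(8, 4)` is exactly `BoxVanishing 8`: one way,
compare a vanishing box-rational representation on `(0,1)⁸` with the ZERO representation on `(0,1)⁴`
(box-rational, value `0`, itself a relation by rule 1b)) — `boxVanishing_eight_of_stub_boxRigidity_var2325`;
the other way, pad both representations to `(0,1)⁸` by Newton–Leibniz moves and subtract on the common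
box (`boxRigidityLe_eight_of_boxVanishing_eight`, file `…Variants2319`, from the tree's `pad_le` /
`sub_same` and soundness). Hence
`V2325 ⟺ BoxVanishing 8 ⟺ BoxRigidity for all m, m' ≤ 8 ⟺ V2319 (pair (8,2)) ⟺ the swapped pair (4,8)`
(`stub_boxRigidity_var2325_iff_boxVanishing_eight`, `…_iff_le_eight`, `…_iff_var2319`, `…_iff_swap`):
freezing the idle slot to `4` instead of `2`, `3` or `8` does not change the strength. Downward, V2325
gives `BoxVanishing j` for every `j ≤ 8` (`boxVanishing_le_eight_of_stub_boxRigidity_var2325`) and every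
frozen pair `(j, k)` with `j, k ≤ 8` (`boxRigidityFix_of_stub_boxRigidity_var2325`), in particular the
diagonal pair `(4, 4)` of its own right slot (`stub_boxRigidity_fix_four_four_of_var2325`):
Conjecture 1 for all pairs of rational integrands over `ℚ` on `(0,1)⁴`, which already contains the open
dichotomies "`a + b·ζ(3) + c·π² = 0 ⇒ [a + b/(1−xyz) + 6c/((1−xy))]`-type representations are relations"
and Catalan's `a + b·G = 0 ⇒ [a + b/(1+x²y²)]_{(0,1)²}` is a relation — provable today only through the
(open) irrationality / independence statements or through an explicit chain of moves, which cannot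
exist unless the numbers are in fact dependent. Upward `KontsevichZagierPeriods → parent → V2325`
(`stub_boxRigidity_var2325_of_statement`), so a refutation of the variant would refute the Summit
(Conjecture 1 for the tree's calculus); the tree's invariants finer than `KZ.eval` (`algShadow`, `Λcov`,
`emptyCount` in `Theorems/NormalFormPrinciple/Negative/`) are invariants of proper SUB-calculi only and
die under the full set of rules, so neither side is accessible. The proved two-sided frontier stays
`max j k ≤ 1` (Baker; `boxRigidityLe_of_max_le_one`, file `…Variants2340`).
Source: M. Kontsevich, D. Zagier, *Periods* (2001), §1.2 Conjecture 1 and rules 1)–3).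
Pure proof file, no definitions. -/

-- `Summit.<Summit>.<Problem>` is the tree's mandated summit-side namespace (CONVENTIONS §2); for this
-- single-conjunct summit the two coincide, so the duplicate is deliberate.
set_option linter.dupNamespace false

noncomputable section

namespace Summit.KontsevichZagierPeriods.KontsevichZagierPeriods.Theorems

open MeasureTheory Set
open Literature.NumberTheory.Transcendental Literature.NumberTheory.Transcendental.KZ
open Summit.KontsevichZagierPeriods.KontsevichZagierPeriods.Theses.HurwitzMicroSectors
open Summit.KontsevichZagierPeriods.HurwitzMicroSectors.NormalFormPrinciple.PiBox
open Summit.KontsevichZagierPeriods.HurwitzMicroSectors.NormalFormPrinciple.PiBox.stub_boxCombineAux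
  (pad_le)

/-! ## V2325 ⇒ `BoxVanishing 8` -/

/-- **V2325 ⇒ `BoxVanishing 8`**: a box-rational representation on `(0,1)⁸` of value `0` is, by the
variant, KZ-equivalent to the zero representation on `(0,1)⁴` (box-rational, value `0`), which is
itself a relation (rule 1b): `[0] = [0] + [0]`). [cite: KontsevichZagier2001, §1.2 Conjecture 1] -/
theorem boxVanishing_eight_of_stub_boxRigidity_var2325
    (h : ∀ (N : IntegralRep 8) (N' : IntegralRep 4), N.domain = {x | ∀ i, x i ∈ Set.Ioo (0:ℝ) 1} → N.IsRational → N'.domain = {x | ∀ i, x i ∈ Set.Ioo (0:ℝ) 1} → N'.IsRational → N.value = N'.value → Equivalent N N')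
    (M : IntegralRep 8) (hMd : M.domain = {x | ∀ i, x i ∈ Set.Ioo (0:ℝ) 1}) (hMr : M.IsRational)
    (hv : M.value = 0) : of M ∈ relations := by
  obtain ⟨Z, hZd, hZi⟩ := exists_zeroRep (isSemialgebraic_box 4)
  have hZ : of Z ∈ relations := of_mem_relations_of_eqOn_zero Z (by simp [hZi, EqOn])
  have hZv : Z.value = 0 := by simp [IntegralRep.value, hZi]
  have hZr : Z.IsRational := ⟨0, 1, fun x _ => by simp, fun x _ => by simp [hZi]⟩
  have hMZ : of M - of Z ∈ relations := h M Z hMd hMr hZd hZr (by rw [hv, hZv])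
  simpa using relations.add_mem hMZ hZ

/-! ## The variant V2325 itself: exactly `BoxVanishing 8` -/

/-- **V2325 ⟺ `BoxVanishing 8`** (backward: pad both representations to `(0,1)⁸` and subtract there —
`boxRigidityLe_eight_of_boxVanishing_eight` at the allowed pair `(8, 4)`, `4 ≤ 8`).
[cite: KontsevichZagier2001, §1.2 Conjecture 1] -/
theorem stub_boxRigidity_var2325_iff_boxVanishing_eight :
    (∀ (N : IntegralRep 8) (N' : IntegralRep 4), N.domain = {x | ∀ i, x i ∈ Set.Ioo (0:ℝ) 1} → N.IsRational → N'.domain = {x | ∀ i, x i ∈ Set.Ioo (0:ℝ) 1} → N'.IsRational → N.value = N'.value → Equivalent N N') ↔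
    (∀ (M : IntegralRep 8), M.domain = {x | ∀ i, x i ∈ Set.Ioo (0:ℝ) 1} → M.IsRational →
      M.value = 0 → of M ∈ relations) :=
  ⟨boxVanishing_eight_of_stub_boxRigidity_var2325,
    fun hvan N N' => boxRigidityLe_eight_of_boxVanishing_eight hvan 8 4 N N' le_rfl (by norm_num)⟩

/-- **V2325 ⟺ `BoxRigidity` for all `m, m' ≤ 8`** (the honest strength of the variant: Conjecture 1 for
all pairs of rational integrands over `ℚ` on the open unit boxes of dimension at most `8`; freezing the
right slot to `4` loses nothing, by padding). [cite: KontsevichZagier2001, §1.2 Conjecture 1] -/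
theorem stub_boxRigidity_var2325_iff_le_eight :
    (∀ (N : IntegralRep 8) (N' : IntegralRep 4), N.domain = {x | ∀ i, x i ∈ Set.Ioo (0:ℝ) 1} → N.IsRational → N'.domain = {x | ∀ i, x i ∈ Set.Ioo (0:ℝ) 1} → N'.IsRational → N.value = N'.value → Equivalent N N') ↔
    (∀ (m m' : ℕ) (N : IntegralRep m) (N' : IntegralRep m'), m ≤ 8 → m' ≤ 8 →
      N.domain = {x | ∀ i, x i ∈ Set.Ioo (0:ℝ) 1} → N.IsRational →
      N'.domain = {x | ∀ i, x i ∈ Set.Ioo (0:ℝ) 1} → N'.IsRational →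
      N.value = N'.value → Equivalent N N') :=
  ⟨fun h => boxRigidityLe_eight_of_boxVanishing_eight (boxVanishing_eight_of_stub_boxRigidity_var2325 h),
    fun h N N' => h 8 4 N N' le_rfl (by norm_num)⟩

/-- **V2325 ⟺ the sibling V2319** (`fix_nat:m=8; fix_nat:m'=2`): both are `BoxVanishing 8`; which
dimension `≤ 8` the idle right slot is frozen to does not change the strength.
[cite: KontsevichZagier2001, §1.2 Conjecture 1] -/
theorem stub_boxRigidity_var2325_iff_var2319 :
    (∀ (N : IntegralRep 8) (N' : IntegralRep 4), N.domain = {x | ∀ i, x i ∈ Set.Ioo (0:ℝ) 1} → N.IsRational → N'.domain = {x | ∀ i, x i ∈ Set.Ioo (0:ℝ) 1} → N'.IsRational → N.value = N'.value → Equivalent N N') ↔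
    (∀ (N : IntegralRep 8) (N' : IntegralRep 2), N.domain = {x | ∀ i, x i ∈ Set.Ioo (0:ℝ) 1} →
      N.IsRational → N'.domain = {x | ∀ i, x i ∈ Set.Ioo (0:ℝ) 1} → N'.IsRational →
      N.value = N'.value → Equivalent N N') := by
  rw [stub_boxRigidity_var2325_iff_boxVanishing_eight, stub_boxRigidity_var2319_iff_boxVanishing_eight]

/-- **V2325 is the same statement as the swapped pair `(4, 8)`** (symmetry of `Equivalent`:
relations form a subgroup). [cite: KontsevichZagier2001, §1.2 Conjecture 1] -/
theorem stub_boxRigidity_var2325_iff_swap :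
    (∀ (N : IntegralRep 8) (N' : IntegralRep 4), N.domain = {x | ∀ i, x i ∈ Set.Ioo (0:ℝ) 1} → N.IsRational → N'.domain = {x | ∀ i, x i ∈ Set.Ioo (0:ℝ) 1} → N'.IsRational → N.value = N'.value → Equivalent N N') ↔
    (∀ (N : IntegralRep 4) (N' : IntegralRep 8), N.domain = {x | ∀ i, x i ∈ Set.Ioo (0:ℝ) 1} →
      N.IsRational → N'.domain = {x | ∀ i, x i ∈ Set.Ioo (0:ℝ) 1} → N'.IsRational →
      N.value = N'.value → Equivalent N N') := by
  constructor <;> intro h N N' hNd hNr hN'd hN'r hv <;>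
    simpa [Equivalent] using relations.neg_mem (h N' N hN'd hN'r hNd hNr hv.symm)

/-! ## Consequences: all lower dimensions, all frozen pairs of maximal dimension `≤ 8` -/

/-- **V2325 ⇒ `BoxVanishing` in every dimension `j ≤ 8`** (pad to `(0,1)⁸`; the value is unchanged by
soundness): in particular the dimension-`5` statement containing the `ζ(5)` dichotomy, the
dimension-`3` one (`ζ(3)` against `ℚ + ℚπ²`) and the dimension-`2` one containing Catalan's constant.
[cite: KontsevichZagier2001, §1.2 Conjecture 1] -/
theorem boxVanishing_le_eight_of_stub_boxRigidity_var2325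
    (h : ∀ (N : IntegralRep 8) (N' : IntegralRep 4), N.domain = {x | ∀ i, x i ∈ Set.Ioo (0:ℝ) 1} → N.IsRational → N'.domain = {x | ∀ i, x i ∈ Set.Ioo (0:ℝ) 1} → N'.IsRational → N.value = N'.value → Equivalent N N')
    {j : ℕ} (hj : j ≤ 8) (N : IntegralRep j) (hNd : N.domain = {x | ∀ i, x i ∈ Set.Ioo (0:ℝ) 1})
    (hNr : N.IsRational) (hv : N.value = 0) : of N ∈ relations := by
  obtain ⟨R, hRd, hRr, hR⟩ := pad_le hj N hNd hNr
  have hRv : R.value = 0 := by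
    have e := relations_le_ker_eval_holds hR
    simp only [AddMonoidHom.mem_ker, map_sub, eval_of] at e
    linarith
  have := relations.add_mem hR (boxVanishing_eight_of_stub_boxRigidity_var2325 h R hRd hRr hRv)
  rwa [sub_add_cancel] at this

/-- **V2325 ⇒ every frozen pair `(j, k)` with `j, k ≤ 8`** (all two-sided siblings of maximal dimension
at most `8` at once). [cite: KontsevichZagier2001, §1.2 Conjecture 1] -/
theorem boxRigidityFix_of_stub_boxRigidity_var2325
    (h : ∀ (N : IntegralRep 8) (N' : IntegralRep 4), N.domain = {x | ∀ i, x i ∈ Set.Ioo (0:ℝ) 1} → N.IsRational → N'.domain = {x | ∀ i, x i ∈ Set.Ioo (0:ℝ) 1} → N'.IsRational → N.value = N'.value → Equivalent N N')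
    {j k : ℕ} (hj : j ≤ 8) (hk : k ≤ 8) :
    ∀ (N : IntegralRep j) (N' : IntegralRep k), N.domain = {x | ∀ i, x i ∈ Set.Ioo (0:ℝ) 1} →
      N.IsRational → N'.domain = {x | ∀ i, x i ∈ Set.Ioo (0:ℝ) 1} → N'.IsRational →
      N.value = N'.value → Equivalent N N' :=
  fun N N' => stub_boxRigidity_var2325_iff_le_eight.1 h j k N N' hj hk

/-- **V2325 ⇒ the diagonal pair `(4, 4)` of its own right slot**: Conjecture 1 for all pairs of
rational integrands over `ℚ` on `(0,1)⁴` (open: it contains the `ζ(3)`-versus-`ℚ + ℚπ²` and the Catalan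
dichotomies). [cite: KontsevichZagier2001, §1.2 Conjecture 1] -/
theorem stub_boxRigidity_fix_four_four_of_var2325
    (h : ∀ (N : IntegralRep 8) (N' : IntegralRep 4), N.domain = {x | ∀ i, x i ∈ Set.Ioo (0:ℝ) 1} → N.IsRational → N'.domain = {x | ∀ i, x i ∈ Set.Ioo (0:ℝ) 1} → N'.IsRational → N.value = N'.value → Equivalent N N') :
    ∀ (N : IntegralRep 4) (N' : IntegralRep 4), N.domain = {x | ∀ i, x i ∈ Set.Ioo (0:ℝ) 1} →
      N.IsRational → N'.domain = {x | ∀ i, x i ∈ Set.Ioo (0:ℝ) 1} → N'.IsRational →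
      N.value = N'.value → Equivalent N N' :=
  boxRigidityFix_of_stub_boxRigidity_var2325 h (by norm_num) (by norm_num)

/-! ## From above: the residual, the parent leaf, the Summit -/

/-- **`BoxVanishing 8` alone already proves V2325** (the honest residual of the variant: whoever settles
Conjecture 1 for vanishing box-rational periods of dimension `8` settles V2325, and conversely).
[cite: KontsevichZagier2001, §1.2 Conjecture 1] -/
theorem stub_boxRigidity_var2325_of_boxVanishing_eight
    (hvan : ∀ (M : IntegralRep 8), M.domain = {x | ∀ i, x i ∈ Set.Ioo (0:ℝ) 1} → M.IsRational →
      M.value = 0 → of M ∈ relations) :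
    ∀ (N : IntegralRep 8) (N' : IntegralRep 4), N.domain = {x | ∀ i, x i ∈ Set.Ioo (0:ℝ) 1} → N.IsRational → N'.domain = {x | ∀ i, x i ∈ Set.Ioo (0:ℝ) 1} → N'.IsRational → N.value = N'.value → Equivalent N N' :=
  stub_boxRigidity_var2325_iff_boxVanishing_eight.2 hvan

/-- **The parent leaf ⇒ V2325** (specialisation `m := 8`, `m' := 4`; the converse is not claimed — the
parent is `BoxVanishing` in ALL dimensions). [cite: KontsevichZagier2001, §1.2 Conjecture 1] -/
theorem stub_boxRigidity_var2325_of_parent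
    (h : ∀ (m m' : ℕ) (N : IntegralRep m) (N' : IntegralRep m'), N.domain = {x | ∀ i, x i ∈ Set.Ioo (0:ℝ) 1} → N.IsRational → N'.domain = {x | ∀ i, x i ∈ Set.Ioo (0:ℝ) 1} → N'.IsRational → N.value = N'.value → Equivalent N N') :
    ∀ (N : IntegralRep 8) (N' : IntegralRep 4), N.domain = {x | ∀ i, x i ∈ Set.Ioo (0:ℝ) 1} → N.IsRational → N'.domain = {x | ∀ i, x i ∈ Set.Ioo (0:ℝ) 1} → N'.IsRational → N.value = N'.value → Equivalent N N' :=
  h 8 4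

/-- **`KontsevichZagierPeriods ⇒ V2325`**: the variant is a special case of Conjecture 1 for the tree's
calculus (`leaves_of_statement`) — so a refutation of the variant would refute the Summit.
[cite: KontsevichZagier2001, §1.2 Conjecture 1] -/
theorem stub_boxRigidity_var2325_of_statement (h : _root_.KontsevichZagierPeriods) :
    ∀ (N : IntegralRep 8) (N' : IntegralRep 4), N.domain = {x | ∀ i, x i ∈ Set.Ioo (0:ℝ) 1} → N.IsRational → N'.domain = {x | ∀ i, x i ∈ Set.Ioo (0:ℝ) 1} → N'.IsRational → N.value = N'.value → Equivalent N N' :=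
  stub_boxRigidity_var2325_of_parent (leaves_of_statement h).1

end Summit.KontsevichZagierPeriods.KontsevichZagierPeriods.Theorems

end
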